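import Summits.AtomisticToContinuum.Crystallization.Theses.ChessboardParticlePlanes
import Literature.Algebra.EuclideanLattices.GaussianLatticeSums
import Summits.AtomisticToContinuum.Crystallization.Theorems.ChessboardParticlePlanesLjPlaneChessboardPeriodicTwoColour

/-!
# Crux `ChessboardParticlePlanes.LjPlaneChessboard` (stmt-AtomisticToContinuum-6709), line `Sketch` —
# two-colour accounting from a LOAD BOUND

The certificate blocks of the crux couple two layer motifs `F`, `G` of one planar lattice `L` with
complex Bloch weights `α, β` through a radial profile `Ψ : ℝ → ℝ`; their real-space lattice forms
must be non-negative.  The landed `periodicTwoColour_nonneg` does this for profiles under the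
packing proxy; the numerically valid certificates are instead NON-NEGATIVE profiles obeying a
LOAD BOUND (`Σ_{y ∈ G} Σ'_v Ψ ‖x − y + v‖ ≤ Ψ 0` for every `x ∈ F`, and symmetrically).  This file
is the accounting lemma from the load bound; it needs no separation hypothesis:

* `twoColour_nonneg_of_loadBound` — with `X` the cross sum (the two cross sums agree by
  `tsum_latticeShift_swap` and `Finset.sum_comm`), `0 ≤ X ≤ min(|F|,|G|) Ψ0` (load bounds),
  the same-colour sums are `≥ |F| Ψ0`, `≥ |G| Ψ0` (keep only the diagonal `x' = x`, `v = 0` of a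
  non-negative summable family), `|Re(conj α β)| ≤ ‖α‖ ‖β‖`, and
  `‖α‖²|F|Ψ0 + ‖β‖²|G|Ψ0 − 2‖α‖‖β‖ min(|F|,|G|) Ψ0 ≥ min(|F|,|G|) Ψ0 (‖α‖ − ‖β‖)² ≥ 0`.

[folklore; the "partner accounting" of the crux idea card `mismatch-field-certificate`, load-bound
form]
-/

noncomputable section

namespace Summit.AtomisticToContinuum.Crystallization.Theorems.ChessboardParticlePlanesLjPlaneChessboard

open Literature.MathematicalPhysics.StatisticalMechanics
open Literature.Algebra.EuclideanLattices
open scoped Real InnerProductSpace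

/-- **Two-colour accounting from a load bound (registered sub-goal of the crux).**
Let `L` be a planar lattice, `Ψ : ℝ → ℝ` a non-negative profile whose periodisations
`v ↦ Ψ ‖x − y + v‖` are summable over `L`, `F`, `G` finite planar sets obeying the load bounds
`Σ_{y ∈ G} Σ'_v Ψ ‖x − y + v‖ ≤ Ψ 0` (`x ∈ F`) and `Σ_{x ∈ F} Σ'_v Ψ ‖y − x + v‖ ≤ Ψ 0` (`y ∈ G`),
and `α, β ∈ ℂ`.  Then
`0 ≤ ‖α‖² Σ_{x,x' ∈ F} Σ'_v Ψ ‖x − x' + v‖ + ‖β‖² Σ_{y,y' ∈ G} Σ'_v Ψ ‖y − y' + v‖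
 − Re(conj α β) · (Σ_{x ∈ F, y ∈ G} Σ'_v Ψ ‖x − y + v‖ + Σ_{y ∈ G, x ∈ F} Σ'_v Ψ ‖y − x + v‖)`.
Proof: the same-colour sums dominate their diagonal terms `x' = x`, `v = 0`, so are `≥ |F| Ψ0`,
`≥ |G| Ψ0`; the two cross sums agree (`tsum_latticeShift_swap`, `Finset.sum_comm`) and the common
value `X ≥ 0` satisfies `X ≤ |F| Ψ0` and `X ≤ |G| Ψ0` by the two load bounds; with
`m = min(|F|,|G|)` and `|Re(conj α β)| ≤ ‖α‖ ‖β‖` the form is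
`≥ (‖α‖²|F| + ‖β‖²|G| − 2‖α‖‖β‖ m) Ψ0 ≥ m Ψ0 (‖α‖ − ‖β‖)² ≥ 0`. [folklore] -/
theorem twoColour_nonneg_of_loadBound :
    ∀ (L : Submodule ℤ (EuclideanSpace ℝ (Fin 2))) [DiscreteTopology L] [IsZLattice ℝ L]
      (Ψ : ℝ → ℝ) (F G : Finset (EuclideanSpace ℝ (Fin 2))) (α β : ℂ),
      (∀ d : ℝ, 0 ≤ Ψ d) →
      (∀ (x y : EuclideanSpace ℝ (Fin 2)),
        Summable (fun v : L => Ψ ‖x - y + (v : EuclideanSpace ℝ (Fin 2))‖)) →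
      (∀ x ∈ F, ∑ y ∈ G, ∑' v : L, Ψ ‖x - y + (v : EuclideanSpace ℝ (Fin 2))‖ ≤ Ψ 0) →
      (∀ y ∈ G, ∑ x ∈ F, ∑' v : L, Ψ ‖y - x + (v : EuclideanSpace ℝ (Fin 2))‖ ≤ Ψ 0) →
      0 ≤ ‖α‖ ^ 2 * (∑ x ∈ F, ∑ x' ∈ F, ∑' v : L, Ψ ‖x - x' + (v : EuclideanSpace ℝ (Fin 2))‖)
          + ‖β‖ ^ 2 * (∑ y ∈ G, ∑ y' ∈ G, ∑' v : L, Ψ ‖y - y' + (v : EuclideanSpace ℝ (Fin 2))‖)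
          - (starRingEnd ℂ α * β).re *
              ((∑ x ∈ F, ∑ y ∈ G, ∑' v : L, Ψ ‖x - y + (v : EuclideanSpace ℝ (Fin 2))‖)
               + (∑ y ∈ G, ∑ x ∈ F, ∑' v : L, Ψ ‖y - x + (v : EuclideanSpace ℝ (Fin 2))‖)) := by
  intro L _ _ Ψ F G α β hΨ hsum hloadF hloadG
  have hΨ0 : 0 ≤ Ψ 0 := hΨ 0
  -- same-colour sums dominate their diagonal: `Σ_{x,x' ∈ H} Σ'_v Ψ ‖x − x' + v‖ ≥ |H| Ψ0`
  have hdiag : ∀ H : Finset (EuclideanSpace ℝ (Fin 2)),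
      (H.card : ℝ) * Ψ 0
        ≤ ∑ x ∈ H, ∑ x' ∈ H, ∑' v : L, Ψ ‖x - x' + (v : EuclideanSpace ℝ (Fin 2))‖ := by
    intro H
    have hrow : ∀ x ∈ H,
        Ψ 0 ≤ ∑ x' ∈ H, ∑' v : L, Ψ ‖x - x' + (v : EuclideanSpace ℝ (Fin 2))‖ := by
      intro x hx
      calc Ψ 0 = (fun v : L => Ψ ‖x - x + (v : EuclideanSpace ℝ (Fin 2))‖) 0 := by
            simp only [sub_self, zero_add, Submodule.coe_zero, norm_zero]
        _ ≤ ∑' v : L, Ψ ‖x - x + (v : EuclideanSpace ℝ (Fin 2))‖ :=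
            (hsum x x).le_tsum 0 fun v _ => hΨ _
        _ ≤ ∑ x' ∈ H, ∑' v : L, Ψ ‖x - x' + (v : EuclideanSpace ℝ (Fin 2))‖ :=
            Finset.single_le_sum
              (f := fun x' => ∑' v : L, Ψ ‖x - x' + (v : EuclideanSpace ℝ (Fin 2))‖)
              (fun x' _ => tsum_nonneg fun v => hΨ _) hx
    calc (H.card : ℝ) * Ψ 0 = ∑ _x ∈ H, Ψ 0 := by rw [Finset.sum_const, nsmul_eq_mul]
      _ ≤ _ := Finset.sum_le_sum hrow
  have hFF := hdiag F
  have hGG := hdiag G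
  -- the two cross sums agree
  have hswap : ∑ y ∈ G, ∑ x ∈ F, ∑' v : L, Ψ ‖y - x + (v : EuclideanSpace ℝ (Fin 2))‖
      = ∑ x ∈ F, ∑ y ∈ G, ∑' v : L, Ψ ‖x - y + (v : EuclideanSpace ℝ (Fin 2))‖ := by
    rw [Finset.sum_comm]
    exact Finset.sum_congr rfl fun x _ => Finset.sum_congr rfl fun y _ =>
      tsum_latticeShift_swap L Ψ x y
  -- cross-sum bounds from the two load bounds: `0 ≤ X ≤ |F| Ψ0`, `X ≤ |G| Ψ0`
  have hXF : ∑ x ∈ F, ∑ y ∈ G, ∑' v : L, Ψ ‖x - y + (v : EuclideanSpace ℝ (Fin 2))‖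
      ≤ (F.card : ℝ) * Ψ 0 := by
    calc _ ≤ ∑ _x ∈ F, Ψ 0 := Finset.sum_le_sum hloadF
      _ = (F.card : ℝ) * Ψ 0 := by rw [Finset.sum_const, nsmul_eq_mul]
  have hXG : ∑ y ∈ G, ∑ x ∈ F, ∑' v : L, Ψ ‖y - x + (v : EuclideanSpace ℝ (Fin 2))‖
      ≤ (G.card : ℝ) * Ψ 0 := by
    calc _ ≤ ∑ _y ∈ G, Ψ 0 := Finset.sum_le_sum hloadG
      _ = (G.card : ℝ) * Ψ 0 := by rw [Finset.sum_const, nsmul_eq_mul]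
  have hX0 : 0 ≤ ∑ x ∈ F, ∑ y ∈ G, ∑' v : L, Ψ ‖x - y + (v : EuclideanSpace ℝ (Fin 2))‖ :=
    Finset.sum_nonneg fun x _ => Finset.sum_nonneg fun y _ => tsum_nonneg fun v => hΨ _
  rw [hswap] at hXG
  rw [hswap]
  set X := ∑ x ∈ F, ∑ y ∈ G, ∑' v : L, Ψ ‖x - y + (v : EuclideanSpace ℝ (Fin 2))‖ with hX
  set SF := ∑ x ∈ F, ∑ x' ∈ F, ∑' v : L, Ψ ‖x - x' + (v : EuclideanSpace ℝ (Fin 2))‖ with hSF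
  set SG := ∑ y ∈ G, ∑ y' ∈ G, ∑' v : L, Ψ ‖y - y' + (v : EuclideanSpace ℝ (Fin 2))‖ with hSG
  -- finish: `X ≤ m Ψ0`, `|Re(conj α β)| ≤ ‖α‖ ‖β‖`
  set m := min (F.card : ℝ) (G.card : ℝ) with hm
  have hmF : m ≤ (F.card : ℝ) := min_le_left _ _
  have hmG : m ≤ (G.card : ℝ) := min_le_right _ _
  have hm0 : 0 ≤ m := le_min (Nat.cast_nonneg _) (Nat.cast_nonneg _)
  have hXm : X ≤ m * Ψ 0 := by
    rcases le_total (F.card : ℝ) (G.card : ℝ) with h | h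
    · rw [hm, min_eq_left h]; exact hXF
    · rw [hm, min_eq_right h]; exact hXG
  set r := (starRingEnd ℂ α * β).re with hr
  have hrabs : |r| ≤ ‖α‖ * ‖β‖ := by
    calc |r| ≤ ‖starRingEnd ℂ α * β‖ := Complex.abs_re_le_norm _
      _ = ‖α‖ * ‖β‖ := by rw [norm_mul, Complex.norm_conj]
  have hrX : r * (X + X) ≤ ‖α‖ * ‖β‖ * (2 * (m * Ψ 0)) := by
    calc r * (X + X) ≤ |r * (X + X)| := le_abs_self _
      _ = |r| * |X + X| := abs_mul r _
      _ ≤ ‖α‖ * ‖β‖ * (2 * (m * Ψ 0)) := by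
          refine mul_le_mul hrabs ?_ (abs_nonneg _) (mul_nonneg (norm_nonneg _) (norm_nonneg _))
          rw [abs_of_nonneg (by linarith)]
          linarith
  have hkey : ‖α‖ * ‖β‖ * (2 * (m * Ψ 0))
      ≤ ‖α‖ ^ 2 * ((F.card : ℝ) * Ψ 0) + ‖β‖ ^ 2 * ((G.card : ℝ) * Ψ 0) := by
    have e1 : ‖α‖ ^ 2 * (m * Ψ 0) ≤ ‖α‖ ^ 2 * ((F.card : ℝ) * Ψ 0) :=
      mul_le_mul_of_nonneg_left (mul_le_mul_of_nonneg_right hmF hΨ0) (sq_nonneg _)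
    have e2 : ‖β‖ ^ 2 * (m * Ψ 0) ≤ ‖β‖ ^ 2 * ((G.card : ℝ) * Ψ 0) :=
      mul_le_mul_of_nonneg_left (mul_le_mul_of_nonneg_right hmG hΨ0) (sq_nonneg _)
    have e3 : 0 ≤ (‖α‖ - ‖β‖) ^ 2 * (m * Ψ 0) := mul_nonneg (sq_nonneg _) (mul_nonneg hm0 hΨ0)
    nlinarith
  have hA : ‖α‖ ^ 2 * ((F.card : ℝ) * Ψ 0) ≤ ‖α‖ ^ 2 * SF :=
    mul_le_mul_of_nonneg_left hFF (sq_nonneg _)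
  have hB : ‖β‖ ^ 2 * ((G.card : ℝ) * Ψ 0) ≤ ‖β‖ ^ 2 * SG :=
    mul_le_mul_of_nonneg_left hGG (sq_nonneg _)
  linarith

end Summit.AtomisticToContinuum.Crystallization.Theorems.ChessboardParticlePlanesLjPlaneChessboard

end
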